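import Literature.Probability.NegativeDependence.StronglyRayleighNegativeAssociation
import Literature.Combinatorics.StablePolynomials.ProperPosition
import Literature.Probability.MarkovChains.StochasticDomination
import HarnessLib

/-!
# Proper position implies stochastic domination for strongly Rayleigh measures
# (Borcea–Brändén–Liggett, Def. 2.14, Def. 4.1 and Proposition 4.12)

J. Borcea, P. Brändén, T. M. Liggett, *Negative dependence and the geometry of polynomials*, J. Amer. Math.
Soc. 22 (2009) 521–567 (arXiv:0707.2340, held `paper:arxiv-0707.2340`; numbering of the arXiv version).
Verbatim:

> (§2.4) **Definition 2.14.** If `μ, ν ∈ 𝔓_n` are such that `μ(𝒜) ≥ ν(𝒜)` for any increasing event `𝒜` on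
> `2^[n]` one says that `μ` stochastically dominates `ν`, written `μ ≽ ν` or `ν ≼ μ`.
>
> (§4.3.1, after Theorem 4.11 [`f, g ∈ ℝ[z_1,…,z_n]`: (1) `g + if` is stable ⟺ (2) `g + z_{n+1} f` is real
> stable ⟺ (3) …]) We say that the polynomials `f, g` are in proper position, written `f ≪ g`, if any of the
> equivalent conditions in Theorem 4.11 are satisfied. […] **Definition 4.1.** Let `SR_n` be the set of
> strongly Rayleigh probability measures on `2^[n]`. First, define a (preliminary) partial order `⊴′` on `SR_n`
> by setting `μ ⊴′ ν` if there exists a sequence of strongly Rayleigh probability measures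
> `μ = μ_0, μ_1, …, μ_ℓ = ν` such that `g_{μ_0} ≪ g_{μ_1} ≪ ⋯ ≪ g_{μ_ℓ}`. Then define the partial order `⊴` on
> `SR_n` as the closure of `⊴′`, i.e., set `μ ⊴ ν` if there are two sequences `{μ_j}`, `{ν_j} ⊂ SR_n` such
> that `lim μ_j = μ`, `lim ν_j = ν`, and `μ_j ⊴′ ν_j` for all `j ∈ ℕ` (as the measures are defined on `2^[n]`
> it does not matter what notion of limit we use). […] The anti-symmetry of `⊴` follows from our next result.
>
> **Proposition 4.12.** Let `μ` and `ν` be strongly Rayleigh probability measures on `2^[n]`. Then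
> `μ ⊴ ν ⟹ μ ≼ ν`.
> *Proof.* Clearly, we may assume that `g_μ ≪ g_ν`, so that by Theorem 4.11 the polynomial in `n+1` variables
> `G = (g_ν + z_{n+1} g_μ)/2` is stable. Let `γ ∈ 𝔓_{n+1}` be the measure with generating polynomial `G`. By
> Theorem 4.9, `γ` is NA. Let `𝒜` be an increasing event not depending on the last coordinate and set
> `ℬ = {S ∈ 2^[n+1] : n+1 ∈ S}`. Then `½ μ(𝒜) = γ(𝒜 ∩ ℬ) ≤ γ(𝒜) γ(ℬ) = (½ μ(𝒜) + ½ ν(𝒜)) ½`, which gives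
> `μ(𝒜) ≤ ν(𝒜)`. □

## Transposition

* Weights `μ : Finset σ → ℝ` on the subsets of a finite type `σ` as in `FederMihail.lean` /
  `StronglyRayleighNegativeAssociation.lean` (`ex`, `mass`, `StableOrZero`, `DeterminedBy`); a probability
  measure is `μ ≥ 0` with `mass μ = 1`; "strongly Rayleigh" = `StableOrZero` (it is implied by either side of
  a proper position, tree `IsProperPosition.eq_zero_or_isRealStable_left/right`).
* `f ≪ g` is the tree's `IsProperPosition f g` (`StablePolynomials/ProperPosition.lean`, condition (1));
  Theorem 4.11 (1) ⟺ (2) is the tree's `isProperPosition_iff_isRealStable_add_X_mul` (new variable `none` of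
  `Option σ`), which is exactly what the proof uses.
* `μ ≼ ν` is the tree's `Literature.Probability.MarkovChains.StochDom μ ν` (`E_μ F ≤ E_ν F` for every increasing
  `F : 2^σ → ℝ`, Levin–Peres); §1 shows it is BBL's Def. 2.14 (increasing events) for weights of equal mass —
  both forms of every conclusion are given.
* `γ` lives on `2^{Option σ}` (`none` = the coordinate `n+1`): `pencilWeight μ ν`, generating polynomial
  `g_ν + z_none g_μ` (the factor `½` is dropped; NA in the cross-multiplied form `E[FG]·γ(Ω) ≤ E[F]·E[G]` of
  `StableOrZero.negAssoc` is homogeneous). The event `𝒜` is replaced by an increasing function `F` lifted as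
  `F ∘ eraseNone`; the displayed computation becomes `E_μ[F]·(μ(Ω)+ν(Ω)) ≤ (E_μ[F]+E_ν[F])·μ(Ω)`, i.e.
  `E_μ[F] ≤ E_ν[F]` when `μ(Ω) = ν(Ω) > 0` (and trivially when `μ = ν = 0`). Only `mass μ = mass ν` is needed,
  not mass `1`.
* Def. 4.1: `SRStep μ ν` (one link `g_μ ≪ g_ν` between probability weights), `SRLe' μ ν` (`⊴′`: `μ ∈ SR_n` and a
  finite chain of links, `Relation.ReflTransGen`), `SRLe μ ν` (`⊴`: limits in `Finset σ → ℝ` of `⊴′`-related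
  sequences). Prop. 4.12 is proved for `⊴` without assuming `μ, ν ∈ SR_n` (not needed), and the remark "the
  anti-symmetry of `⊴` follows" is `SRLe.antisymm`.

## Contents

* §1 `lawMean_eq_ex`, `stochDom_iff_forall_upperSet` (Def. 2.14 ⟺ tree `StochDom` under equal mass).
* §2 `pencilWeight` and its bookkeeping (`mass_pencilWeight`, `ex_pencilWeight_comp_eraseNone`,
  `ex_pencilWeight_comp_eraseNone_mul_topInd`, `ex_pencilWeight_topInd`), `sum_pencilWeight_mul_prod`
  (generating polynomial), `stableOrZero_pencilWeight` (Thm. 4.11).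
* §3 **`ex_le_ex_of_isProperPosition`** (Prop. 4.12 core), `stochDom_of_isProperPosition`,
  `sum_le_sum_of_isProperPosition` (events).
* §4 `SRStep`, `SRLe'`, `SRLe` (Def. 4.1), `SRLe'.ex_le_ex`, **`SRLe.ex_le_ex` / `SRLe.stochDom` /
  `SRLe.sum_le_sum_of_isUpperSet`** (Prop. 4.12), `eq_of_stochDom_of_stochDom`, `SRLe.antisymm`.

## References

* [BorceaBrandenLiggett2007] J. Borcea, P. Brändén, T. M. Liggett, Negative dependence and the geometry of
  polynomials, J. Amer. Math. Soc. 22 (2009), 521–567; arXiv:0707.2340.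
* [BorceaBranden2009] J. Borcea, P. Brändén, The Lee–Yang and Pólya–Schur programs I, Invent. Math. 177 (2009)
  (proper position, Lemma 1.8 = BBL Thm. 4.11; tree `ProperPosition.lean`).
* [LevinPeres2017] D. A. Levin, Y. Peres, Markov Chains and Mixing Times, 2nd ed., §22.2 (stochastic domination;
  tree `MarkovChains/StochasticDomination.lean`).
-/

noncomputable section

open Finset MvPolynomial Filter
open scoped Topology
open Literature.Combinatorics.Sahi2008
open Literature.Combinatorics.StablePolynomials
open Literature.Probability.MarkovChains (StochDom lawMean)

namespace Literature.Probability.NegativeDependence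

variable {σ : Type*} [Fintype σ] [DecidableEq σ]

/-! ## §1 Stochastic domination (BBL Def. 2.14) for weights on `2^σ` -/

section StochDom

omit [DecidableEq σ] in
/-- The tree's `lawMean` (Levin–Peres `E_μ f`) is the tree's `ex` (Sahi `E_μ f`): both are `Σ_S μ(S) f(S)`.
[cite: BorceaBrandenLiggett2007, §2.1 Def. 2.7 (`∫ F dμ`)] -/
theorem lawMean_eq_ex (μ F : Finset σ → ℝ) : lawMean μ F = ex μ F := rfl

/-- **BBL Def. 2.14 versus the tree's `StochDom`.** For weights of equal total mass (in particular for two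
probability measures), `μ ≼ ν` in the sense of the tree (`E_μ F ≤ E_ν F` for every increasing `F`,
Levin–Peres) iff `μ(𝒜) ≤ ν(𝒜)` for every increasing event `𝒜` (BBL Def. 2.14: "`ν` stochastically dominates
`μ`"). [cite: BorceaBrandenLiggett2007, §2.4 Def. 2.14] -/
theorem stochDom_iff_forall_upperSet {μ ν : Finset σ → ℝ} (hmass : mass μ = mass ν) :
    StochDom μ ν ↔ ∀ 𝒜 : Finset (Finset σ), IsUpperSet (𝒜 : Set (Finset σ)) → ∑ S ∈ 𝒜, μ S ≤ ∑ S ∈ 𝒜, ν S := by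
  classical
  constructor
  · intro h 𝒜 h𝒜
    have key := h.sum_le_of_isUpperSet (U := (𝒜 : Set (Finset σ))) h𝒜
    simpa only [Finset.mem_coe, Finset.filter_mem_eq_inter, Finset.univ_inter] using key
  · intro h
    refine Literature.Probability.MarkovChains.stochDom_of_upperSets hmass fun U hU _ => ?_
    have hup : IsUpperSet ((univ.filter (· ∈ U) : Finset (Finset σ)) : Set (Finset σ)) := by
      intro S T hST hS
      rw [Finset.mem_coe, Finset.mem_filter] at hS ⊢
      exact ⟨Finset.mem_univ _, hU hST hS.2⟩
    have key := h _ hup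
    convert key using 2

omit [DecidableEq σ] in
/-- `μ ≼ ν` tested on an increasing function. [cite: BorceaBrandenLiggett2007, §2.4 Def. 2.14] -/
theorem StochDom.ex_le {μ ν : Finset σ → ℝ} (h : StochDom μ ν) {F : Finset σ → ℝ} (hF : Monotone F) :
    ex μ F ≤ ex ν F :=
  h F hF

end StochDom

/-! ## §2 The pencil weight `γ` with generating polynomial `g_ν + z_{n+1} g_μ` -/

section Pencil

/-- **The pencil weight** on `2^{σ ⊔ {∗}}` (`Option σ`, `∗ = none`): `γ(S) = ν(S)`, `γ(S ∪ {∗}) = μ(S)` for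
`S ⊆ σ`; its generating polynomial is `g_ν(z) + z_∗ g_μ(z)` (BBL: "`G = (g_ν + z_{n+1} g_μ)/2` … Let
`γ ∈ 𝔓_{n+1}` be the measure with generating polynomial `G`", the factor `1/2` dropped).
[cite: BorceaBrandenLiggett2007, §4.3.1 proof of Prop. 4.12] -/
def pencilWeight (μ ν : Finset σ → ℝ) : Finset (Option σ) → ℝ := fun U =>
  if none ∈ U then μ (Finset.eraseNone U) else ν (Finset.eraseNone U)

omit [Fintype σ] in
/-- Unfolding `pencilWeight`. [cite: BorceaBrandenLiggett2007, §4.3.1 proof of Prop. 4.12] -/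
theorem pencilWeight_apply (μ ν : Finset σ → ℝ) (U : Finset (Option σ)) :
    pencilWeight μ ν U = if none ∈ U then μ (Finset.eraseNone U) else ν (Finset.eraseNone U) := rfl

omit [Fintype σ] in
/-- `γ(S ∪ {∗}) = μ(S)`. [cite: BorceaBrandenLiggett2007, §4.3.1 proof of Prop. 4.12] -/
@[simp] theorem pencilWeight_insertNone (μ ν : Finset σ → ℝ) (S : Finset σ) :
    pencilWeight μ ν (insertNone S) = μ S := by
  rw [pencilWeight_apply, if_pos Finset.none_mem_insertNone, Finset.eraseNone_insertNone]

omit [Fintype σ] in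
/-- `γ(S) = ν(S)` for `S ⊆ σ`. [cite: BorceaBrandenLiggett2007, §4.3.1 proof of Prop. 4.12] -/
@[simp] theorem pencilWeight_map_some (μ ν : Finset σ → ℝ) (S : Finset σ) :
    pencilWeight μ ν (S.map Function.Embedding.some) = ν S := by
  rw [pencilWeight_apply, if_neg (by simp), Finset.eraseNone_map_some]

omit [Fintype σ] in
/-- `γ ≥ 0` for `μ, ν ≥ 0`. [cite: BorceaBrandenLiggett2007, §4.3.1 proof of Prop. 4.12] -/
theorem pencilWeight_nonneg {μ ν : Finset σ → ℝ} (hμ : ∀ S, 0 ≤ μ S) (hν : ∀ S, 0 ≤ ν S)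
    (U : Finset (Option σ)) : 0 ≤ pencilWeight μ ν U := by
  rw [pencilWeight_apply]
  split_ifs
  · exact hμ _
  · exact hν _

omit [DecidableEq σ] in
/-- Sums over `2^{σ ⊔ {∗}}` split into the sets avoiding `∗` (`S ⊆ σ`) and those containing it (`S ∪ {∗}`).
[folklore] -/
private theorem sum_finset_option {M : Type*} [AddCommMonoid M] (f : Finset (Option σ) → M) :
    ∑ U, f U = ∑ S : Finset σ, f (S.map Function.Embedding.some) + ∑ S : Finset σ, f (insertNone S) := by
  classical
  rw [← Finset.sum_filter_add_sum_filter_not univ (fun U : Finset (Option σ) => none ∉ U)]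
  congr 1
  · symm
    refine Finset.sum_nbij' (fun S => S.map Function.Embedding.some) (fun U => Finset.eraseNone U)
      (fun S _ => Finset.mem_filter.2 ⟨Finset.mem_univ _, by simp⟩) (fun _ _ => Finset.mem_univ _)
      (fun S _ => Finset.eraseNone_map_some S) (fun U hU => ?_) fun _ _ => rfl
    rw [Finset.map_some_eraseNone, Finset.erase_eq_of_notMem (Finset.mem_filter.1 hU).2]
  · symm
    refine Finset.sum_nbij' (fun S => insertNone S) (fun U => Finset.eraseNone U)
      (fun S _ => Finset.mem_filter.2 ⟨Finset.mem_univ _, not_not.2 Finset.none_mem_insertNone⟩)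
      (fun _ _ => Finset.mem_univ _) (fun S _ => Finset.eraseNone_insertNone S) (fun U hU => ?_) fun _ _ => rfl
    rw [Finset.insertNone_eraseNone, Finset.insert_eq_of_mem (not_not.1 (Finset.mem_filter.1 hU).2)]

/-- `γ(Ω) = μ(Ω) + ν(Ω)`. [cite: BorceaBrandenLiggett2007, §4.3.1 proof of Prop. 4.12] -/
theorem mass_pencilWeight (μ ν : Finset σ → ℝ) : mass (pencilWeight μ ν) = mass ν + mass μ := by
  rw [mass, sum_finset_option]
  simp only [pencilWeight_map_some, pencilWeight_insertNone]
  rfl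

/-- The indicator of `ℬ = {S : ∗ ∈ S}`. [cite: BorceaBrandenLiggett2007, §4.3.1 proof of Prop. 4.12 ("set
`ℬ = {S ∈ 2^[n+1] : n+1 ∈ S}`")] -/
def topInd : Finset (Option σ) → ℝ := fun U => if none ∈ U then 1 else 0

omit [Fintype σ] in
/-- Unfolding `topInd`. [cite: BorceaBrandenLiggett2007, §4.3.1 proof of Prop. 4.12] -/
theorem topInd_apply (U : Finset (Option σ)) : (topInd U : ℝ) = if none ∈ U then 1 else 0 := rfl

omit [Fintype σ] in
/-- `ℬ` is increasing. [cite: BorceaBrandenLiggett2007, §4.3.1 proof of Prop. 4.12] -/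
theorem monotone_topInd : Monotone (topInd : Finset (Option σ) → ℝ) := by
  intro U V hUV
  simp only [topInd_apply]
  by_cases hU : none ∈ U
  · rw [if_pos hU, if_pos (hUV hU)]
  · rw [if_neg hU]
    split_ifs <;> norm_num

omit [Fintype σ] in
/-- `ℬ` depends on the last coordinate only. [cite: BorceaBrandenLiggett2007, §4.3.1 proof of Prop. 4.12] -/
theorem determinedBy_topInd : DeterminedBy (topInd : Finset (Option σ) → ℝ) {none} := by
  intro U V hUV
  have h : none ∈ U ↔ none ∈ V := by
    have hU : none ∈ U ↔ none ∈ U ∩ {none} := by simp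
    have hV : none ∈ V ↔ none ∈ V ∩ {none} := by simp
    rw [hU, hV, hUV]
  rw [topInd_apply, topInd_apply, if_congr h rfl rfl]

omit [Fintype σ] [DecidableEq σ] in
/-- Lifting `F` from `2^σ` to `2^{σ ⊔ {∗}}` by ignoring `∗` keeps monotonicity ("an increasing event not depending
on the last coordinate"). [cite: BorceaBrandenLiggett2007, §4.3.1 proof of Prop. 4.12] -/
theorem monotone_comp_eraseNone {F : Finset σ → ℝ} (hF : Monotone F) :
    Monotone (F ∘ (Finset.eraseNone : Finset (Option σ) → Finset σ)) :=
  fun _ _ hUV => hF (Finset.eraseNone.monotone hUV)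

omit [Fintype σ] in
/-- The lift of `F` does not depend on the last coordinate. [cite: BorceaBrandenLiggett2007, §4.3.1 proof of
Prop. 4.12] -/
theorem determinedBy_comp_eraseNone [Fintype σ] (F : Finset σ → ℝ) :
    DeterminedBy (F ∘ (Finset.eraseNone : Finset (Option σ) → Finset σ))
      ((univ : Finset σ).map Function.Embedding.some) := by
  intro U V hUV
  simp only [Function.comp_apply]
  congr 1
  ext a
  rw [Finset.mem_eraseNone, Finset.mem_eraseNone]
  have ha : some a ∈ (univ : Finset σ).map Function.Embedding.some := Finset.mem_map_of_mem _ (Finset.mem_univ a)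
  constructor
  · intro h
    exact (Finset.mem_inter.1 ((Finset.ext_iff.1 hUV (some a)).1 (Finset.mem_inter.2 ⟨h, ha⟩))).1
  · intro h
    exact (Finset.mem_inter.1 ((Finset.ext_iff.1 hUV (some a)).2 (Finset.mem_inter.2 ⟨h, ha⟩))).1

/-- `E_γ[F̃] = E_ν[F] + E_μ[F]`. [cite: BorceaBrandenLiggett2007, §4.3.1 proof of Prop. 4.12
("`γ(𝒜) = ½ μ(𝒜) + ½ ν(𝒜)`")] -/
theorem ex_pencilWeight_comp_eraseNone (μ ν F : Finset σ → ℝ) :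
    ex (pencilWeight μ ν) (F ∘ (Finset.eraseNone : Finset (Option σ) → Finset σ)) = ex ν F + ex μ F := by
  rw [ex, sum_finset_option]
  simp only [Function.comp_apply, pencilWeight_map_some, pencilWeight_insertNone, Finset.eraseNone_map_some,
    Finset.eraseNone_insertNone]
  rfl

/-- `E_γ[F̃ · 𝟙_ℬ] = E_μ[F]`. [cite: BorceaBrandenLiggett2007, §4.3.1 proof of Prop. 4.12
("`½ μ(𝒜) = γ(𝒜 ∩ ℬ)`")] -/
theorem ex_pencilWeight_comp_eraseNone_mul_topInd (μ ν F : Finset σ → ℝ) :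
    ex (pencilWeight μ ν) ((F ∘ (Finset.eraseNone : Finset (Option σ) → Finset σ)) * topInd) = ex μ F := by
  rw [ex, sum_finset_option]
  simp only [Pi.mul_apply, Function.comp_apply, pencilWeight_map_some, pencilWeight_insertNone,
    Finset.eraseNone_map_some, Finset.eraseNone_insertNone, topInd_apply, Finset.none_mem_insertNone, if_true,
    mul_one]
  have h0 : ∀ S : Finset σ, (if none ∈ S.map Function.Embedding.some then (1 : ℝ) else 0) = 0 :=
    fun S => if_neg (by simp)
  simp only [h0, mul_zero, Finset.sum_const_zero, zero_add]
  rfl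

/-- `E_γ[𝟙_ℬ] = μ(Ω)`. [cite: BorceaBrandenLiggett2007, §4.3.1 proof of Prop. 4.12 ("`γ(ℬ) = ½`")] -/
theorem ex_pencilWeight_topInd (μ ν : Finset σ → ℝ) : ex (pencilWeight μ ν) topInd = mass μ := by
  have key := ex_pencilWeight_comp_eraseNone_mul_topInd μ ν (fun _ => 1)
  have h1 : ((fun _ : Finset σ => (1 : ℝ)) ∘ (Finset.eraseNone : Finset (Option σ) → Finset σ)) * topInd
      = topInd := by
    funext U
    simp
  rw [h1] at key
  rw [key, ex, mass]
  simp

/-- **The generating polynomial of `γ` is `g_ν(z) + z_∗ g_μ(z)`.** [cite: BorceaBrandenLiggett2007, §4.3.1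
proof of Prop. 4.12 ("the polynomial in `n+1` variables `G = (g_ν + z_{n+1} g_μ)/2`")] -/
theorem sum_pencilWeight_mul_prod (μ ν : Finset σ → ℝ) (z : Option σ → ℂ) :
    (∑ U : Finset (Option σ), (pencilWeight μ ν U : ℂ) * ∏ u ∈ U, z u) =
      MvPolynomial.eval z (MvPolynomial.map (algebraMap ℝ ℂ)
        (rename some (multiAffine ν) + X none * rename some (multiAffine μ))) := by
  rw [sum_finset_option]
  simp only [pencilWeight_map_some, pencilWeight_insertNone, Finset.prod_map, Function.Embedding.some_apply,
    Finset.prod_insertNone]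
  rw [map_add, map_mul, map_X, map_rename, map_rename, map_multiAffine, map_multiAffine, map_add, map_mul,
    eval_X, eval_rename, eval_rename, eval_multiAffine, eval_multiAffine]
  simp only [Function.comp_apply, Finset.mul_sum]
  congr 1
  refine Finset.sum_congr rfl fun S _ => ?_
  simp only [Complex.coe_algebraMap]
  ring

/-- **`γ` is strongly Rayleigh when `g_μ ≪ g_ν`** (BBL Thm. 4.11 (1) ⇒ (2): `g_ν + z_{n+1} g_μ` is real stable;
tree `isProperPosition_iff_isRealStable_add_X_mul`). [cite: BorceaBrandenLiggett2007, §4.3.1 Thm. 4.11 and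
proof of Prop. 4.12 ("so that by Theorem 4.11 the polynomial … `G` … is stable")] -/
theorem stableOrZero_pencilWeight {μ ν : Finset σ → ℝ}
    (h : IsProperPosition (multiAffine μ) (multiAffine ν)) : StableOrZero (pencilWeight μ ν) := by
  right
  intro z hz
  rw [sum_pencilWeight_mul_prod]
  exact (isProperPosition_iff_isRealStable_add_X_mul _ _).1 h z hz

end Pencil

/-! ## §3 Proposition 4.12: proper position ⟹ stochastic domination -/

section ProperPosition

omit [DecidableEq σ] in
/-- **Borcea–Brändén–Liggett, Proposition 4.12 (core step).** If `μ, ν ≥ 0` have the same total mass and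
their generating polynomials are in proper position, `g_μ ≪ g_ν`, then `E_μ[F] ≤ E_ν[F]` for every increasing
`F`. Printed proof: `γ` (generating polynomial `(g_ν + z_{n+1} g_μ)/2`, stable by Thm. 4.11) is NA by
Theorem 4.9; with `𝒜` increasing not depending on the last coordinate and `ℬ = {S : n+1 ∈ S}`,
`½ μ(𝒜) = γ(𝒜 ∩ ℬ) ≤ γ(𝒜) γ(ℬ) = (½ μ(𝒜) + ½ ν(𝒜)) · ½`, which gives `μ(𝒜) ≤ ν(𝒜)` (here with an
increasing function `F` for the event `𝒜`). [cite: BorceaBrandenLiggett2007, §4.3.1 Prop. 4.12 and its proof] -/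
theorem ex_le_ex_of_isProperPosition {μ ν : Finset σ → ℝ} (h : IsProperPosition (multiAffine μ) (multiAffine ν))
    (hμ : ∀ S, 0 ≤ μ S) (hν : ∀ S, 0 ≤ ν S) (hmass : mass μ = mass ν) {F : Finset σ → ℝ} (hF : Monotone F) :
    ex μ F ≤ ex ν F := by
  classical
  have key := (stableOrZero_pencilWeight h).negAssoc (pencilWeight_nonneg hμ hν) (monotone_comp_eraseNone hF)
    monotone_topInd (determinedBy_comp_eraseNone F) determinedBy_topInd
    (Finset.disjoint_singleton_right.2 (by simp))
  rw [ex_pencilWeight_comp_eraseNone_mul_topInd, ex_pencilWeight_comp_eraseNone, ex_pencilWeight_topInd,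
    mass_pencilWeight, ← hmass] at key
  -- `key : ex μ F * (m + m) ≤ (ex ν F + ex μ F) * m`, `m = mass μ`
  rcases (mass_nonneg hμ).eq_or_lt with hm | hm
  · have hμ0 : ∀ S, μ S = 0 := fun S => eq_zero_of_mass_eq_zero hμ hm.symm S
    have hν0 : ∀ S, ν S = 0 := fun S => eq_zero_of_mass_eq_zero hν (hmass ▸ hm.symm) S
    simp [ex, hμ0, hν0]
  · nlinarith

omit [DecidableEq σ] in
/-- **Proposition 4.12 (core step), stochastic domination form**: `g_μ ≪ g_ν`, `μ, ν ≥ 0` of equal mass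
`⟹ μ ≼ ν` (tree `StochDom`). [cite: BorceaBrandenLiggett2007, §4.3.1 Prop. 4.12] -/
theorem stochDom_of_isProperPosition {μ ν : Finset σ → ℝ} (h : IsProperPosition (multiAffine μ) (multiAffine ν))
    (hμ : ∀ S, 0 ≤ μ S) (hν : ∀ S, 0 ≤ ν S) (hmass : mass μ = mass ν) : StochDom μ ν :=
  fun _ hF => ex_le_ex_of_isProperPosition h hμ hν hmass hF

omit [DecidableEq σ] in
/-- **Proposition 4.12 (core step), as printed for events**: `μ(𝒜) ≤ ν(𝒜)` for every increasing event `𝒜`.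
[cite: BorceaBrandenLiggett2007, §4.3.1 Prop. 4.12; §2.4 Def. 2.14] -/
theorem sum_le_sum_of_isProperPosition {μ ν : Finset σ → ℝ}
    (h : IsProperPosition (multiAffine μ) (multiAffine ν)) (hμ : ∀ S, 0 ≤ μ S) (hν : ∀ S, 0 ≤ ν S)
    (hmass : mass μ = mass ν) {𝒜 : Finset (Finset σ)} (h𝒜 : IsUpperSet (𝒜 : Set (Finset σ))) :
    ∑ S ∈ 𝒜, μ S ≤ ∑ S ∈ 𝒜, ν S := by
  classical
  exact (stochDom_iff_forall_upperSet hmass).1 (stochDom_of_isProperPosition h hμ hν hmass) 𝒜 h𝒜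

end ProperPosition

/-! ## §4 The partial orders `⊴′`, `⊴` on `SR_n` (Def. 4.1) and Proposition 4.12 as printed -/

section PartialOrder

/-- One step `g_μ ≪ g_ν` between strongly Rayleigh PROBABILITY measures (`μ, ν ≥ 0` of mass `1`; proper
position already forces both generating polynomials to be real stable or zero, tree
`IsProperPosition.eq_zero_or_isRealStable_left/right`). [cite: BorceaBrandenLiggett2007, §4.3.1 Def. 4.1] -/
def SRStep (μ ν : Finset σ → ℝ) : Prop :=
  ((∀ S, 0 ≤ μ S) ∧ mass μ = 1) ∧ ((∀ S, 0 ≤ ν S) ∧ mass ν = 1) ∧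
    IsProperPosition (multiAffine μ) (multiAffine ν)

/-- **BBL Def. 4.1, the preliminary order `μ ⊴′ ν`**: "there exists a sequence of strongly Rayleigh probability
measures `μ = μ_0, μ_1, …, μ_ℓ = ν` such that `g_{μ_0} ≪ g_{μ_1} ≪ ⋯ ≪ g_{μ_ℓ}`" — `μ` is a strongly Rayleigh
probability measure (the case `ℓ = 0`) and `ν` is reached from `μ` by finitely many `SRStep`s.
[cite: BorceaBrandenLiggett2007, §4.3.1 Def. 4.1 (`⊴′`)] -/
def SRLe' (μ ν : Finset σ → ℝ) : Prop :=
  ((∀ S, 0 ≤ μ S) ∧ mass μ = 1 ∧ StableOrZero μ) ∧ Relation.ReflTransGen SRStep μ ν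

/-- **BBL Def. 4.1, the order `μ ⊴ ν`** = the closure of `⊴′`: "there are two sequences `{μ_j}`, `{ν_j} ⊂ SR_n`
such that `lim μ_j = μ`, `lim ν_j = ν`, and `μ_j ⊴′ ν_j` for all `j ∈ ℕ`" (pointwise limits of weights on the
finite set `2^σ`: "it does not matter what notion of limit we use"). [cite: BorceaBrandenLiggett2007, §4.3.1
Def. 4.1 (`⊴`)] -/
def SRLe (μ ν : Finset σ → ℝ) : Prop :=
  ∃ μs νs : ℕ → Finset σ → ℝ,
    Tendsto μs atTop (𝓝 μ) ∧ Tendsto νs atTop (𝓝 ν) ∧ ∀ j, SRLe' (μs j) (νs j)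

omit [DecidableEq σ] in
/-- `⊴′ ⊆ ⊴` (constant sequences). [cite: BorceaBrandenLiggett2007, §4.3.1 Def. 4.1] -/
theorem SRLe'.srLe {μ ν : Finset σ → ℝ} (h : SRLe' μ ν) : SRLe μ ν :=
  ⟨fun _ => μ, fun _ => ν, tendsto_const_nhds, tendsto_const_nhds, fun _ => h⟩

omit [DecidableEq σ] in
/-- A single proper-position step between strongly Rayleigh probability measures is a `⊴′` relation.
[cite: BorceaBrandenLiggett2007, §4.3.1 Def. 4.1] -/
theorem SRStep.srLe' {μ ν : Finset σ → ℝ} (h : SRStep μ ν) : SRLe' μ ν := by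
  refine ⟨⟨h.1.1, h.1.2, ?_⟩, Relation.ReflTransGen.single h⟩
  rw [stableOrZero_iff]
  exact h.2.2.eq_zero_or_isRealStable_left

omit [DecidableEq σ] in
/-- Along `⊴′` every term is a probability weight with `E_μ F ≤ E_{μ_j} F` for increasing `F` (induction on the
chain, Prop. 4.12 core step at each link). [cite: BorceaBrandenLiggett2007, §4.3.1 proof of Prop. 4.12 ("Clearly,
we may assume that `g_μ ≪ g_ν`")] -/
theorem SRLe'.ex_le_ex {μ ν : Finset σ → ℝ} (h : SRLe' μ ν) {F : Finset σ → ℝ} (hF : Monotone F) :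
    ex μ F ≤ ex ν F := by
  classical
  obtain ⟨_, hchain⟩ := h
  induction hchain with
  | refl => exact le_rfl
  | tail _ hstep ih =>
    exact ih.trans
      (ex_le_ex_of_isProperPosition hstep.2.2 hstep.1.1 hstep.2.1.1 (hstep.1.2.trans hstep.2.1.2.symm) hF)

omit [DecidableEq σ] in
/-- `⊴′`-related measures have the same (unit) mass. [cite: BorceaBrandenLiggett2007, §4.3.1 Def. 4.1] -/
theorem SRLe'.mass_eq {μ ν : Finset σ → ℝ} (h : SRLe' μ ν) : mass μ = 1 ∧ mass ν = 1 := by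
  obtain ⟨hμ, hchain⟩ := h
  refine ⟨hμ.2.1, ?_⟩
  induction hchain with
  | refl => exact hμ.2.1
  | tail _ hstep _ => exact hstep.2.1.2

omit [DecidableEq σ] in
/-- Expectations `μ ↦ E_μ F` are continuous in the weight (a finite sum of coordinates). [folklore] -/
private theorem tendsto_ex {μs : ℕ → Finset σ → ℝ} {μ : Finset σ → ℝ} (h : Tendsto μs atTop (𝓝 μ))
    (F : Finset σ → ℝ) : Tendsto (fun j => ex (μs j) F) atTop (𝓝 (ex μ F)) := by
  simp only [ex]
  refine tendsto_finsetSum _ fun S _ => ?_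
  exact ((continuous_apply S).tendsto μ |>.comp h).mul_const _

omit [DecidableEq σ] in
/-- **Borcea–Brändén–Liggett, Proposition 4.12.** "Let `μ` and `ν` be strongly Rayleigh probability measures on
`2^[n]`. Then `μ ⊴ ν ⟹ μ ≼ ν`": for every increasing `F`, `E_μ F ≤ E_ν F` (pass to the limit in the chains
of Def. 4.1). [cite: BorceaBrandenLiggett2007, §4.3.1 Prop. 4.12] -/
theorem SRLe.ex_le_ex {μ ν : Finset σ → ℝ} (h : SRLe μ ν) {F : Finset σ → ℝ} (hF : Monotone F) :
    ex μ F ≤ ex ν F := by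
  obtain ⟨μs, νs, hμ, hν, hj⟩ := h
  exact le_of_tendsto_of_tendsto' (tendsto_ex hμ F) (tendsto_ex hν F) fun j => (hj j).ex_le_ex hF

omit [DecidableEq σ] in
/-- **Proposition 4.12, stochastic domination form**: `μ ⊴ ν ⟹ μ ≼ ν` (tree `StochDom`: `E_μ F ≤ E_ν F` for all
increasing `F`). [cite: BorceaBrandenLiggett2007, §4.3.1 Prop. 4.12] -/
theorem SRLe.stochDom {μ ν : Finset σ → ℝ} (h : SRLe μ ν) : StochDom μ ν := fun _ hF => h.ex_le_ex hF

omit [DecidableEq σ] in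
/-- `⊴`-related measures have the same mass (limits of unit masses). [cite: BorceaBrandenLiggett2007, §4.3.1
Def. 4.1] -/
theorem SRLe.mass_eq {μ ν : Finset σ → ℝ} (h : SRLe μ ν) : mass μ = mass ν := by
  obtain ⟨μs, νs, hμ, hν, hj⟩ := h
  have h1 : ∀ ρ : Finset σ → ℝ, mass ρ = ex ρ fun _ => 1 := fun ρ => by simp [mass, ex]
  have hμ1 : Tendsto (fun j => mass (μs j)) atTop (𝓝 (mass μ)) := by simpa only [h1] using tendsto_ex hμ _
  have hν1 : Tendsto (fun j => mass (νs j)) atTop (𝓝 (mass ν)) := by simpa only [h1] using tendsto_ex hν _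
  have hμc : Tendsto (fun j => mass (μs j)) atTop (𝓝 1) :=
    tendsto_const_nhds.congr fun j => ((hj j).mass_eq.1).symm
  have hνc : Tendsto (fun j => mass (νs j)) atTop (𝓝 1) :=
    tendsto_const_nhds.congr fun j => ((hj j).mass_eq.2).symm
  rw [tendsto_nhds_unique hμ1 hμc, tendsto_nhds_unique hν1 hνc]

omit [DecidableEq σ] in
/-- **Proposition 4.12 as printed (Def. 2.14 form)**: `μ ⊴ ν ⟹ μ(𝒜) ≤ ν(𝒜)` for every increasing event `𝒜`.
[cite: BorceaBrandenLiggett2007, §4.3.1 Prop. 4.12; §2.4 Def. 2.14] -/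
theorem SRLe.sum_le_sum_of_isUpperSet {μ ν : Finset σ → ℝ} (h : SRLe μ ν) {𝒜 : Finset (Finset σ)}
    (h𝒜 : IsUpperSet (𝒜 : Set (Finset σ))) : ∑ S ∈ 𝒜, μ S ≤ ∑ S ∈ 𝒜, ν S := by
  classical
  exact (stochDom_iff_forall_upperSet h.mass_eq).1 h.stochDom 𝒜 h𝒜

/-- Stochastic domination both ways forces equality of the weights: test the principal up-sets `{T : S ⊆ T}` and
`{T : S ⊂ T}`. [cite: BorceaBrandenLiggett2007, §4.3.1 ("the stochastic domination relation `≼` defines a partial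
order on `𝔓_n`")] -/
theorem eq_of_stochDom_of_stochDom {μ ν : Finset σ → ℝ} (h₁ : StochDom μ ν) (h₂ : StochDom ν μ) : μ = ν := by
  classical
  have hmass : mass μ = mass ν := h₁.sum_eq
  have hle : ∀ 𝒜 : Finset (Finset σ), IsUpperSet (𝒜 : Set (Finset σ)) → ∑ S ∈ 𝒜, μ S = ∑ S ∈ 𝒜, ν S :=
    fun 𝒜 h𝒜 => le_antisymm ((stochDom_iff_forall_upperSet hmass).1 h₁ 𝒜 h𝒜)
      ((stochDom_iff_forall_upperSet hmass.symm).1 h₂ 𝒜 h𝒜)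
  funext S
  have hup : IsUpperSet ((univ.filter fun T : Finset σ => S ⊆ T : Finset (Finset σ)) : Set (Finset σ)) := by
    intro T T' hTT' hT
    rw [Finset.mem_coe, Finset.mem_filter] at hT ⊢
    exact ⟨Finset.mem_univ _, hT.2.trans hTT'⟩
  have hup' : IsUpperSet ((univ.filter fun T : Finset σ => S ⊂ T : Finset (Finset σ)) : Set (Finset σ)) := by
    intro T T' hTT' hT
    rw [Finset.mem_coe, Finset.mem_filter] at hT ⊢
    exact ⟨Finset.mem_univ _, hT.2.trans_le hTT'⟩
  have hsplit : ∀ ρ : Finset σ → ℝ,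
      ∑ T ∈ univ.filter (fun T : Finset σ => S ⊆ T), ρ T = ρ S + ∑ T ∈ univ.filter (fun T : Finset σ => S ⊂ T), ρ T := by
    intro ρ
    have hS : univ.filter (fun T : Finset σ => S ⊆ T) = insert S (univ.filter fun T : Finset σ => S ⊂ T) := by
      ext T
      simp only [Finset.mem_filter, Finset.mem_univ, true_and, Finset.mem_insert]
      constructor
      · intro h
        exact (eq_or_ne T S).imp id fun hne => lt_of_le_of_ne h (Ne.symm hne)
      · rintro (rfl | h)
        · exact le_rfl
        · exact h.le
    rw [hS, Finset.sum_insert (by simp)]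
  have h1 := hle _ hup
  have h2 := hle _ hup'
  rw [hsplit, hsplit, h2] at h1
  linarith

omit [DecidableEq σ] in
/-- **"The anti-symmetry of `⊴` follows from our next result."** [cite: BorceaBrandenLiggett2007, §4.3.1 (before
Prop. 4.12)] -/
theorem SRLe.antisymm {μ ν : Finset σ → ℝ} (h₁ : SRLe μ ν) (h₂ : SRLe ν μ) : μ = ν := by
  classical
  exact eq_of_stochDom_of_stochDom h₁.stochDom h₂.stochDom

end PartialOrder

end Literature.Probability.NegativeDependence

end
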